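import Literature.Probability.RandomPlanarGeometry.TwoSidedWholePlaneSLEScalingReduction
import Literature.Probability.RandomPlanarGeometry.ArmComplementBoundary
import HarnessLib

/-!
# Self-similarity of two-sided whole-plane SLE_κ (Zhan (2021), Cor. 4.7): the corrected class is closed under dilations

Topic `Probability/RandomPlanarGeometry`; capstone of `TwoSidedWholePlaneSLEScalingLemmas`,
`…Proofs`, `…Reduction` (the closure of the corrected class `IsTwoSidedWholePlaneSLENatLawMeas`
under the dilations `dilatePath (1/d) a`, modulo the continuity theorem `hCT` for conformal maps onto
the remaining domain of the first arm) and `ArmComplementTopology`, `…Cover`, `…Boundary` (that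
continuity theorem, `continuityTheorem_armComplement`, proved). Putting them together:

* `IsTwoSidedWholePlaneSLENatLawMeas.map_dilatePath_mem` — **the dilate of a corrected two-sided
  whole-plane SLE_κ natural law is a corrected natural law**, unconditionally: the formal content of
  "the scaling invariance of `ν^#_{∞⇌0}` and the scaling covariance of the Minkowski content measure"
  in the proof of Zhan (2021), Cor. 4.7, on the probability space carrying the two arms. In
  particular the hypothesis `hcl` of
  `IsTwoSidedWholePlaneSLENatLawMeas.map_dilatePath_of_unique_of_closed(')`
  (`TwoSidedWholePlaneSLEScaling`) holds (`IsTwoSidedWholePlaneSLENatLawMeas.closed`).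
* `IsTwoSidedWholePlaneSLENatLawMeas.map_dilatePath_of_unique` — **Zhan's Corollary 4.7
  (self-similarity) over the corrected class follows from the well-definedness of the corrected law
  alone** (`hu`: two corrected natural laws for the same `κ` coincide — "`ν^#_{∞⇌0}` is ONE law",
  which Zhan's one-line proof presupposes). What `hu` needs and the tree lacks: uniqueness in law
  of whole-plane SLE_κ(2) as defined by `IsWholePlaneSLEKappaRho` (a measurable whole-plane trace
  functional of the driving process), independence of the second arm's conditional law from the
  measurable uniformizer selector (uniqueness of the accesses to the tip `0` and to `∞`), and the
  transfer to the Minkowski content parametrisation across probability spaces.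

## References

* D. Zhan, *SLE loop measures*, PTRF 179 (2021), arXiv:1702.08026 (arXiv numbering): §2.2,
  Cor. 4.7 and its proof (p. 23). [Zhan2021SLELoopMeasures]
* Ch. Pommerenke, *Boundary Behaviour of Conformal Maps* (1992), Thm 2.1. [PommerenkeBBCM1992]
-/

noncomputable section

open Set Filter Topology MeasureTheory
open scoped NNReal

namespace Literature.Probability.RandomPlanarGeometry

open scoped PathBorel

/-- **The corrected class of two-sided whole-plane SLE_κ natural laws is closed under the dilations
`dilatePath (1/d) a`, `a > 0`, `d = 1 + κ/8`** (unconditionally): the dilate of the Minkowski content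
parametrisation of a measurably uniformized two-sided pair is the Minkowski content parametrisation
of the dilated pair, which is again a measurably uniformized two-sided pair on the same space
(`map_dilatePath_mem_of_continuityTheorem`), the boundary regularity of the remaining domain of the
first arm being supplied by the continuity theorem `continuityTheorem_armComplement`. Zhan (2021),
proof of Cor. 4.7 ("the scaling invariance of `ν^#_{∞⇌0}` and the scaling covariance of the
Minkowski content measure"). [cite: Zhan2021SLELoopMeasures, Cor. 4.7 (proof)] -/
theorem IsTwoSidedWholePlaneSLENatLawMeas.map_dilatePath_mem {κ : ℝ≥0} {μ : Measure C(ℝ, ℂ)}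
    (h : IsTwoSidedWholePlaneSLENatLawMeas κ μ) {a : ℝ} (ha : 0 < a) :
    IsTwoSidedWholePlaneSLENatLawMeas κ (μ.map (dilatePath (1 / (1 + (κ : ℝ) / 8)) a)) :=
  IsTwoSidedWholePlaneSLENatLawMeas.map_dilatePath_mem_of_continuityTheorem
    continuityTheorem_armComplement h ha

/-- The closure hypothesis `hcl` of `IsTwoSidedWholePlaneSLENatLawMeas.map_dilatePath_of_unique_of_closed`
(`TwoSidedWholePlaneSLEScaling`) holds: for `0 < κ < 8` (indeed for every `κ`) and every `a > 0`, the
dilate of a corrected natural law is a corrected natural law. [cite: Zhan2021SLELoopMeasures, Cor. 4.7 (proof)] -/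
theorem IsTwoSidedWholePlaneSLENatLawMeas.closed :
    ∀ (κ : ℝ≥0) (μ : Measure C(ℝ, ℂ)), 0 < κ → κ < 8 → IsTwoSidedWholePlaneSLENatLawMeas κ μ →
      ∀ a : ℝ, 0 < a →
        IsTwoSidedWholePlaneSLENatLawMeas κ (μ.map (dilatePath (1 / (1 + (κ : ℝ) / 8)) a)) :=
  fun _ _ _ _ h _ ha ↦ h.map_dilatePath_mem ha

/-- **Zhan's Corollary 4.7 (self-similarity of index `1/d`), corrected class, from well-definedness
alone.** Granted that the corrected two-sided whole-plane SLE_κ natural law is well defined (`hu`: two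
laws of the class `IsTwoSidedWholePlaneSLENatLawMeas κ` coincide — Zhan's `ν̂^#_{∞⇌0}` is one law),
the named fact `IsTwoSidedWholePlaneSLENatLawMeas.map_dilatePath` holds: the dilate of a corrected
natural law is a corrected natural law (`map_dilatePath_mem`), hence equal to it. This is the printed
proof of Zhan (2021), Cor. 4.7 — "the self-similarity of `γ̂₀` follows easily from the scaling
invariance of `ν^#_{∞⇌0}` and the scaling covariance of the Minkowski content measure" — with its one
remaining implicit input, well-definedness, as the hypothesis. [cite: Zhan2021SLELoopMeasures, Cor. 4.7] -/
theorem IsTwoSidedWholePlaneSLENatLawMeas.map_dilatePath_of_unique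
    (hu : ∀ (κ : ℝ≥0) (μ μ' : Measure C(ℝ, ℂ)),
      IsTwoSidedWholePlaneSLENatLawMeas κ μ → IsTwoSidedWholePlaneSLENatLawMeas κ μ' → μ = μ') :
    IsTwoSidedWholePlaneSLENatLawMeas.map_dilatePath :=
  IsTwoSidedWholePlaneSLENatLawMeas.map_dilatePath_of_unique_of_closed hu
    fun _ _ _ _ h _ ha ↦ h.map_dilatePath_mem ha

end Literature.Probability.RandomPlanarGeometry
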